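import Literature.AlgebraicGeometry.HodgeTheory.BettiHodgeConjectureProductsOddPiecesTopOddHom
import Literature.AlgebraicGeometry.Motives.HodgeStructureHodgeClassesProductBound
import HarnessLib

/-!
# `HC(Y × Z)` in ALL dimensions from `HC(Y)`, `HC(Z)` and TWO conditions on the top degrees: `Hom_HS(H^{mₒ}(Y), H^{nₒ}(Z)((nₒ − mₒ)/2)) = 0` (top odd degrees) and
# `dim_ℚ Hom_HS(H^{2μ}(Y), H^{2ν}(Z)(ν − μ)) ≤ ρ_μ(Y) ρ_ν(Z)` (top even degrees) — the top even count governs every even primitive count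
# (Voisin I Cor. 6.26, Rem. 6.27, Lemma 7.23, Lemma 7.26, §11.3.3 Thm. 11.38–11.40, Lemma 11.41, p. 287; Voisin II Prop. 9.20; Hulek–Laface Prop. 2.2; Deligne Hodge II 2.1.13)

Family `hodge`, lane `lit-hodgefound` (Track 2 foundations library; Layers A1/A4), layer `Literature/AlgebraicGeometry/HodgeTheory`.  THEOREMS ONLY (no definition, no named fact,
no instance, no notation; D-0026 net debt `0`).  Prover seat `lit-hodgefound-p21` (generation 39, row g39-#5), sequel of the seat's g39-#1/#2 `BettiLefschetzDecompositionHodgeStructures`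
(`dim Hom_HS(Hⁱ(Y), Hʲ(Z)(s))` and `dim Hdg^q(Hⁱ(X))` as sums over the primitive blocks), g39-#4 `BettiHodgeConjectureProductsOddPiecesTopOddHom` (`HC(Y × Z)` ⟸ `HC(Y)`, `HC(Z)`, ONE
vanishing `Hom_HS(H^{mₒ}Y, H^{nₒ}Z(s)) = 0` in the top odd degrees, and the even primitive counts `dim Hom_HS(P^{2a}Y, P^{2b}Z(b − a)) ≤ ρ₀ᵃ(Y) ρ₀ᵇ(Z)`) and the tree's
`BettiHodgeConjectureProductsMiddlePieceHomBound` (ONE ambient piece without exceptional classes, for off-middle-algebraic factors).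

THE MATHEMATICS.  Let `Y`, `Z` be smooth projective of dimensions `m`, `n`, and `2μ ≤ m`, `2ν ≤ n`.  By the Lefschetz decomposition (Cor. 6.26, Rem. 6.27, Lemma 7.23: `H^{2μ}(Y) =
⊕_{a ≤ μ} L^{μ−a} P^{2a}(Y)`, `L^{μ−a} P^{2a} ≅ P^{2a}(a − μ)`, all `a ≤ μ` occurring since `2μ ≤ m`), `dim Hom_HS(H^{2μ}(Y), H^{2ν}(Z)(ν − μ)) = Σ_{a ≤ μ, b ≤ ν}
dim Hom_HS(P^{2a}(Y), P^{2b}(Z)(b − a))` and `ρ_μ(Y) = dim Hdg^μ(H^{2μ}(Y)) = Σ_{a ≤ μ} ρ₀ᵃ(Y)`, `ρ₀ᵃ(Y) = dim Hdgᵃ(P^{2a}(Y))`.  Each block satisfies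
`dim Hom_HS(P^{2a}(Y), P^{2b}(Z)(b − a)) = dim Hdg^{a+b}(P^{2a}(Y) ⊗ P^{2b}(Z)) ≥ ρ₀ᵃ(Y) ρ₀ᵇ(Z)` (Lemma 11.41 for the polarised primitive parts, Lemma 7.26; the products of Hodge classes are
Hodge classes, linearly independent — Hulek–Laface Prop. 2.2).  Summing, `dim Hom_HS(H^{2μ}Y, H^{2ν}Z(ν − μ)) ≥ ρ_μ(Y) ρ_ν(Z)` always, and **EQUALITY — equivalently the single inequality
`dim Hom_HS(H^{2μ}(Y), H^{2ν}(Z)(ν − μ)) ≤ ρ_μ(Y) ρ_ν(Z)` — forces equality in every block: `dim Hom_HS(P^{2a}Y, P^{2b}Z(b − a)) = ρ₀ᵃ(Y) ρ₀ᵇ(Z)` for all `a ≤ μ`, `b ≤ ν`** (§2), i.e.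
none of the primitive pieces `P^{2a}(Y) ⊗ P^{2b}(Z)` carries an exceptional Hodge class.  With `2μ`, `2ν` the TOP even degrees (`m ≤ 2μ + 1`, `n ≤ 2ν + 1`) these are all the even primitive
counts of g39-#4's criterion, whence (§3): **`HC(Y × Z)` holds as soon as `HC(Y)`, `HC(Z)`, `Hom_HS(H^{mₒ}(Y), H^{nₒ}(Z)((nₒ − mₒ)/2)) = 0` for the top odd degrees `mₒ ≤ m ≤ mₒ + 1`,
`nₒ ≤ n ≤ nₒ + 1`, and `dim_ℚ Hom_HS(H^{2μ}(Y), H^{2ν}(Z)(ν − μ)) ≤ ρ_μ(Y) ρ_ν(Z)` for the top even degrees** — two conditions on morphisms of `ℚ`-Hodge structures between the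
cohomologies of the factors in (at most) their top two degrees `≤ dim`, in all dimensions, with no Kähler data in the statement.  §4 spells out the equidimensional cases (`dim Y = dim Z = 2k`:
`Hom_HS(H^{2k−1}Y, H^{2k−1}Z) = 0` and `dim Hom_HS(H^{2k}Y, H^{2k}Z) ≤ ρ_k(Y)ρ_k(Z)` — two fourfolds: `Hom_HS(H³F, H³F') = 0`, `dim Hom_HS(H⁴F, H⁴F') ≤ ρ₂(F)ρ₂(F')`; `dim = 2k + 1`:
`Hom_HS(H^{2k+1}Y, H^{2k+1}Z) = 0` and `dim Hom_HS(H^{2k}Y, H^{2k}Z) ≤ ρ_k(Y)ρ_k(Z)`, the case `k = 1` being g39-#3's threefold criterion), and `T × F`, `S × F` for a surface `S`, a threefold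
`T`, a fourfold `F`.  §5: when one factor has NO cohomology in its top odd degree (`b_{mₒ}(Y) = 0`, e.g. a surface with `b₁ = 0`, a threefold with `b₃ = 0`, an even-dimensional hypersurface)
the odd condition is void and **`HC(Y × Z)` ⟸ `HC(Y)`, `HC(Z)` and the ONE count `dim Hom_HS(H^{2μ}Y, H^{2ν}Z(ν − μ)) ≤ ρ_μ(Y)ρ_ν(Z)`** — for a surface `S` with `b₁(S) = 0` and any `Z`:
`HC(S × Z)` ⟸ `HC(Z)`, `dim Hom_HS(H²(S), H^{2ν}(Z)(ν − 1)) ≤ ρ(S) ρ_ν(Z)`.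

WHAT IS PROVED (all binders explicit; `P = BettiUniverse.primitiveHodge`, `H = BettiUniverse.hodge`, `ρ_q(HⁱX) = dim_ℚ Hdg^q(Hⁱ(X))`).
* §1 `BettiUniverse.finrank_hodgeClasses_mul_le_finrank_hom_primitiveHodge`: `dim Hdg^α(Pⁱ(Y)) · dim Hdg^β(Pʲ(Z)) ≤ dim Hom_HS(Pⁱ(Y), Pʲ(Z)(s))` (`j − 2s = i`, `α + β = i + s`).
* §2 `BettiUniverse.mul_le_finrank_hom_hodge_tateTwist` (`ρ_μ(Y) ρ_ν(Z) ≤ dim Hom_HS(H^{2μ}Y, H^{2ν}Z(ν − μ))`, any `μ`, `ν`),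
  `BettiUniverse.finrank_hom_primitiveHodge_eq_mul_of_finrank_hom_hodge_le` (the top even count `≤` ⟹ every block count is an equality) and
  `BettiUniverse.finrank_hom_hodge_tateTwist_eq_mul_of_le` (then the top count is an equality too).
* §3 `BettiUniverse.hodgeConjectureFor_tensor_of_subsingleton_hom_hodge_odd_of_finrank_hom_hodge_even_le` (THE CRITERION).
* §4 `BettiUniverse.hodgeConjectureFor_tensor_of_even_dim_of_subsingleton_hom_of_finrank_hom_le` (`dim Y = dim Z = 2k`), `…_of_odd_dim_…` (`2k + 1`),
  `BettiUniverse.hodgeConjectureFor_tensor_fourfolds_of_subsingleton_hom_three_of_finrank_hom_four_le`, `…threefold_tensor_fourfold…`, `…surface_tensor_fourfold…`.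
* §5 one factor WITHOUT cohomology in its top odd degree (`b_{mₒ}(Y) = 0` or `b_{nₒ}(Z) = 0`): `BettiUniverse.subsingleton_hom_hodge_of_finrank_eq_zero`, `…_tateTwist_of_finrank_eq_zero`,
  `BettiUniverse.hodgeConjectureFor_tensor_of_finrank_top_odd_eq_zero_left_of_finrank_hom_hodge_even_le` / `…_right_…` (**`HC(Y × Z)` ⟸ `HC(Y)`, `HC(Z)` and the top even count ALONE**),
  `BettiUniverse.hodgeConjectureFor_surface_tensor_of_finrank_one_eq_zero_of_finrank_hom_hodge_le` (`b₁(S) = 0`: `HC(S × Z)` ⟸ `HC(Z)`, `dim Hom_HS(H²S, H^{2ν}Z(ν − 1)) ≤ ρ(S)ρ_ν(Z)`),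
  `BettiUniverse.hodgeConjectureFor_threefold_tensor_of_finrank_three_eq_zero_of_finrank_hom_hodge_le` (`b₃(T) = 0`: `HC(T × Z)` ⟸ `HC(Z)`, `dim Hom_HS(H²T, H^{2ν}Z(ν − 1)) ≤ ρ(T)ρ_ν(Z)`).

THE PRINTS.  C. Voisin (2002) [VoisinHodgeI2002] §6.2.3 Thm. 6.25, Cor. 6.26, Rem. 6.27 (held text p0125–p0126); §7.1.2 Lemma 7.26 (p0148); §7.3.1 Lemma 7.23, Cor. 7.24 (p0147); §11.3.3
Thm. 11.38, Def. 11.39, Thm. 11.40, Lemma 11.41 (p0236), p. 287; §11.3.1 Thm. 11.30.  C. Voisin (2003) [VoisinHodgeII2003] §9.2.4 Prop. 9.20.  K. Hulek, R. Laface (2019)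
[HulekLaface2019PicardNumbersAV] §2.1 Prop. 2.2 (products of Hodge classes).  P. Deligne (1971) [DeligneHodgeII1971] 2.1, 2.1.13–2.1.15.  P. Deligne (2000) [Deligne2000] §1.  The
consolidation into two top-degree conditions is bookkeeping on these prints (no new mathematics is claimed).

## References
* [VoisinHodgeI2002] C. Voisin, *Hodge Theory and Complex Algebraic Geometry I* (2002) — §6.2.3 Thm. 6.25, Cor. 6.26, Rem. 6.27; §7.1.2 Lemma 7.26; §7.3.1 Lemma 7.23; §11.3.3
  Thm. 11.38–11.40, Lemma 11.41, p. 287; §11.3.1 Thm. 11.30.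
* [VoisinHodgeII2003] C. Voisin, *Hodge Theory and Complex Algebraic Geometry II* (2003) — §9.2.4 Prop. 9.20.
* [HulekLaface2019PicardNumbersAV] K. Hulek, R. Laface, *On the Picard numbers of abelian varieties* (2019) — §2.1 Prop. 2.2.
* [DeligneHodgeII1971] P. Deligne, *Théorie de Hodge II*, Publ. Math. IHÉS 40 (1971) — 2.1, 2.1.13–2.1.15.
* [Deligne2000] P. Deligne, *The Hodge conjecture* (Clay, 2000) — §1.

## Provenance
Lane `lit-hodgefound` (Hodge path, Track 2), prover seat `lit-hodgefound-p21` (generation 39), self-proposed row g39-#5 (sequel of g39-#1–#4).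
-/

noncomputable section

open scoped TensorProduct
open CategoryTheory MonoidalCategory Module Finset
open Literature.AlgebraicTopology.SingularHomology
open Literature.Geometry.Kaehler

namespace Literature.AlgebraicGeometry.HodgeTheory

open Literature.AlgebraicGeometry.Motives
open Literature.AlgebraicGeometry.Motives.HodgeStructure

variable {m n d : ℕ} {Y Z T F F' : SchemeOver ℂ}

section Blocks

/-- **`dim_ℚ Hdg^α(Pⁱ(Y)) · dim_ℚ Hdg^β(Pʲ(Z)) ≤ dim_ℚ Hom_HS(Pⁱ(Y), Pʲ(Z)(s))`** for `j − 2s = i`, `α + β = i + s`: the products `y ⊗ z` of Hodge classes are linearly independent Hodge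
classes of `Pⁱ(Y) ⊗ Pʲ(Z)`, and `dim Hdg^{i+s}(Pⁱ(Y) ⊗ Pʲ(Z)) = dim Hom_HS(Pⁱ(Y), Pʲ(Z)(s))` (Lemma 11.41 for the polarised primitive parts). [cite: VoisinHodgeI2002, §7.1.2 Lemma 7.26 and
§11.3.3 Thm. 11.38, Lemma 11.41 (p. 286)] [cite: HulekLaface2019PicardNumbersAV, §2.1 Prop. 2.2] -/
theorem BettiUniverse.finrank_hodgeClasses_mul_le_finrank_hom_primitiveHodge (hHD : exists_isReal_hodgeModel) (hY : IsSmoothProjective m Y) (hZ : IsSmoothProjective n Z)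
    (DY : KaehlerRationalDatum m Y) (DZ : KaehlerRationalDatum n Z) (i j : ℕ) {s : ℤ} (hs : (j : ℤ) - 2 * s = i) (α β : ℤ) (hαβ : α + β = i + s) :
    Module.finrank ℚ ↥((BettiUniverse.primitiveHodge hHD hY DY i).hodgeClasses α) * Module.finrank ℚ ↥((BettiUniverse.primitiveHodge hHD hZ DZ j).hodgeClasses β) ≤
      Module.finrank ℚ (Hom (BettiUniverse.primitiveHodge hHD hY DY i) (((BettiUniverse.primitiveHodge hHD hZ DZ j).tateTwist s).cast hs)) := by
  haveI : HodgeTensorFacts.{0, 0} := hodgeTensorFacts_holds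
  haveI := BettiUniverse.finite hY i
  haveI := BettiUniverse.finite hZ j
  rw [← BettiUniverse.finrank_hodgeClasses_primitive_tensor_eq_finrank_hom_tateTwist hHD hY hZ DY DZ i j hs, ← hαβ]
  exact finrank_hodgeClasses_mul_le_finrank_hodgeClasses_tensor _ _ α β

end Blocks

section EvenCount

/-- **`ρ_μ(Y) ρ_ν(Z) ≤ dim_ℚ Hom_HS(H^{2μ}(Y), H^{2ν}(Z)(ν − μ))`** (`ρ_μ(Y) = dim Hdg^μ(H^{2μ}Y)`; any `μ`, `ν`): both sides are sums over the admissible blocks `(2a, μ − a)`, `(2b, ν − b)` of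
the Lefschetz decompositions, and blockwise `ρ₀ᵃ(Y) ρ₀ᵇ(Z) ≤ dim Hom_HS(P^{2a}Y, P^{2b}Z(b − a))` (§1). [cite: VoisinHodgeI2002, §6.2.3 Cor. 6.26, Rem. 6.27, §7.3.1 Lemma 7.23, Lemma 7.26 and §11.3.3
Lemma 11.41] [cite: HulekLaface2019PicardNumbersAV, §2.1 Prop. 2.2] -/
theorem BettiUniverse.mul_le_finrank_hom_hodge_tateTwist (hHD : exists_isReal_hodgeModel) (hY : IsSmoothProjective m Y) (hZ : IsSmoothProjective n Z) {μ ν : ℕ} {s : ℤ}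
    (hs : ((2 * ν : ℕ) : ℤ) - 2 * s = ((2 * μ : ℕ) : ℤ)) :
    Module.finrank ℚ ↥((BettiUniverse.hodge hHD hY (2 * μ)).hodgeClasses μ) * Module.finrank ℚ ↥((BettiUniverse.hodge hHD hZ (2 * ν)).hodgeClasses ν) ≤
      Module.finrank ℚ (Hom (BettiUniverse.hodge hHD hY (2 * μ)) (((BettiUniverse.hodge hHD hZ (2 * ν)).tateTwist s).cast hs)) := by
  obtain ⟨DY⟩ := nonempty_kaehlerRationalDatum hY
  obtain ⟨DZ⟩ := nonempty_kaehlerRationalDatum hZ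
  rw [BettiUniverse.finrank_hom_hodge_tateTwist_eq_sum_sum_primitiveHodge hHD hY hZ DY DZ (2 * μ) (2 * ν) hs,
    BettiUniverse.finrank_hodgeClasses_hodge_eq_sum_primitiveHodge hHD hY DY (2 * μ) (μ : ℤ), BettiUniverse.finrank_hodgeClasses_hodge_eq_sum_primitiveHodge hHD hZ DZ (2 * ν) (ν : ℤ),
    Finset.sum_mul_sum]
  refine Finset.sum_le_sum fun p _ ↦ Finset.sum_le_sum fun q _ ↦ ?_
  have hp2 := p.2
  have hq2 := q.2
  by_cases hp : p.1.1 + p.1.2 ≤ m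
  · by_cases hq : q.1.1 + q.1.2 ≤ n
    · rw [if_pos hp, if_pos hq, if_pos ⟨hp, hq⟩]
      exact BettiUniverse.finrank_hodgeClasses_mul_le_finrank_hom_primitiveHodge hHD hY hZ DY DZ p.1.1 q.1.1 _ _ _ (by push_cast at hs ⊢; omega)
    · rw [if_neg hq, mul_zero, if_neg fun h ↦ hq h.2]
  · rw [if_neg hp, zero_mul, if_neg fun h ↦ hp h.1]

/-- **THE TOP EVEN COUNT GOVERNS EVERY EVEN PRIMITIVE COUNT.**  If `2μ ≤ dim Y`, `2ν ≤ dim Z` and `dim_ℚ Hom_HS(H^{2μ}(Y), H^{2ν}(Z)(ν − μ)) ≤ ρ_μ(Y) ρ_ν(Z)`, then for all `a ≤ μ`,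
`b ≤ ν`: **`dim_ℚ Hom_HS(P^{2a}(Y), P^{2b}(Z)(b − a)) = dim_ℚ Hdgᵃ(P^{2a}(Y)) · dim_ℚ Hdgᵇ(P^{2b}(Z))`** — none of the primitive pieces `P^{2a}(Y) ⊗ P^{2b}(Z)` carries an
exceptional Hodge class: the sums over the blocks agree and each block is `≥`, so each block is `=`. [cite: VoisinHodgeI2002, §6.2.3 Cor. 6.26, Rem. 6.27, §7.3.1 Lemma 7.23, Lemma 7.26 and
§11.3.3 Lemma 11.41, p. 287] [cite: HulekLaface2019PicardNumbersAV, §2.1 Prop. 2.2] [cite: DeligneHodgeII1971, 2.1.13–2.1.14] -/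
theorem BettiUniverse.finrank_hom_primitiveHodge_eq_mul_of_finrank_hom_hodge_le (hHD : exists_isReal_hodgeModel) (hY : IsSmoothProjective m Y) (hZ : IsSmoothProjective n Z)
    (DY : KaehlerRationalDatum m Y) (DZ : KaehlerRationalDatum n Z) {μ ν : ℕ} (hμ : 2 * μ ≤ m) (hν : 2 * ν ≤ n) {s : ℤ} (hs : ((2 * ν : ℕ) : ℤ) - 2 * s = ((2 * μ : ℕ) : ℤ))
    (h : Module.finrank ℚ (Hom (BettiUniverse.hodge hHD hY (2 * μ)) (((BettiUniverse.hodge hHD hZ (2 * ν)).tateTwist s).cast hs)) ≤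
      Module.finrank ℚ ↥((BettiUniverse.hodge hHD hY (2 * μ)).hodgeClasses μ) * Module.finrank ℚ ↥((BettiUniverse.hodge hHD hZ (2 * ν)).hodgeClasses ν))
    {a b : ℕ} (ha : a ≤ μ) (hb : b ≤ ν) :
    Module.finrank ℚ (Hom (BettiUniverse.primitiveHodge hHD hY DY (2 * a)) (((BettiUniverse.primitiveHodge hHD hZ DZ (2 * b)).tateTwist ((b : ℤ) - a)).cast (by push_cast; ring))) =
      Module.finrank ℚ ↥((BettiUniverse.primitiveHodge hHD hY DY (2 * a)).hodgeClasses a) * Module.finrank ℚ ↥((BettiUniverse.primitiveHodge hHD hZ DZ (2 * b)).hodgeClasses b) := by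
  rw [BettiUniverse.finrank_hom_hodge_tateTwist_eq_sum_sum_primitiveHodge hHD hY hZ DY DZ (2 * μ) (2 * ν) hs,
    BettiUniverse.finrank_hodgeClasses_hodge_eq_sum_primitiveHodge hHD hY DY (2 * μ) (μ : ℤ), BettiUniverse.finrank_hodgeClasses_hodge_eq_sum_primitiveHodge hHD hZ DZ (2 * ν) (ν : ℤ),
    Finset.sum_mul_sum] at h
  -- blockwise the reverse inequality (§1)
  have hge : ∀ (p : {p : ℕ × ℕ // p.1 + 2 * p.2 = 2 * μ}) (q : {p : ℕ × ℕ // p.1 + 2 * p.2 = 2 * ν}),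
      (if p.1.1 + p.1.2 ≤ m then Module.finrank ℚ ↥((BettiUniverse.primitiveHodge hHD hY DY p.1.1).hodgeClasses ((μ : ℤ) - p.1.2)) else 0) *
          (if q.1.1 + q.1.2 ≤ n then Module.finrank ℚ ↥((BettiUniverse.primitiveHodge hHD hZ DZ q.1.1).hodgeClasses ((ν : ℤ) - q.1.2)) else 0) ≤
        if p.1.1 + p.1.2 ≤ m ∧ q.1.1 + q.1.2 ≤ n then
          Module.finrank ℚ (Hom (BettiUniverse.primitiveHodge hHD hY DY p.1.1)
            (((BettiUniverse.primitiveHodge hHD hZ DZ q.1.1).tateTwist (s + p.1.2 - q.1.2)).cast (by have := p.2; have := q.2; omega)))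
        else 0 := by
    intro p q
    have hp2 := p.2
    have hq2 := q.2
    by_cases hp : p.1.1 + p.1.2 ≤ m
    · by_cases hq : q.1.1 + q.1.2 ≤ n
      · rw [if_pos hp, if_pos hq, if_pos ⟨hp, hq⟩]
        exact BettiUniverse.finrank_hodgeClasses_mul_le_finrank_hom_primitiveHodge hHD hY hZ DY DZ p.1.1 q.1.1 _ _ _ (by push_cast at hs ⊢; omega)
      · rw [if_neg hq, mul_zero, if_neg fun h ↦ hq h.2]
    · rw [if_neg hp, zero_mul, if_neg fun h ↦ hp h.1]
  have heq := (Finset.sum_eq_sum_iff_of_le fun p _ ↦ Finset.sum_le_sum fun q _ ↦ hge p q).1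
    (le_antisymm (Finset.sum_le_sum fun p _ ↦ Finset.sum_le_sum fun q _ ↦ hge p q) h)
  -- the block `((2a, μ − a), (2b, ν − b))`
  have key := (Finset.sum_eq_sum_iff_of_le fun q _ ↦ hge ⟨(2 * a, μ - a), by dsimp only; omega⟩ q).1
    (heq ⟨(2 * a, μ - a), by dsimp only; omega⟩ (Finset.mem_univ _)) ⟨(2 * b, ν - b), by dsimp only; omega⟩ (Finset.mem_univ _)
  dsimp only at key
  rw [if_pos (show 2 * a + (μ - a) ≤ m by omega), if_pos (show 2 * b + (ν - b) ≤ n by omega),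
    if_pos ⟨(show 2 * a + (μ - a) ≤ m by omega), (show 2 * b + (ν - b) ≤ n by omega)⟩] at key
  have e := finrank_hom_twistCast_right_congr (BettiUniverse.primitiveHodge hHD hY DY (2 * a)) (BettiUniverse.primitiveHodge hHD hZ DZ (2 * b))
    (show ((b : ℤ) - a) = s + ((μ - a : ℕ) : ℤ) - ((ν - b : ℕ) : ℤ) by push_cast [Nat.cast_sub ha, Nat.cast_sub hb] at hs ⊢; omega) (by push_cast; ring)
    (by push_cast [Nat.cast_sub ha, Nat.cast_sub hb] at hs ⊢; omega)
  refine e.trans (key.symm.trans ?_)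
  rw [show (μ : ℤ) - ((μ - a : ℕ) : ℤ) = a by push_cast [Nat.cast_sub ha]; ring, show (ν : ℤ) - ((ν - b : ℕ) : ℤ) = b by push_cast [Nat.cast_sub hb]; ring]

/-- Consequently the top even count is itself an EQUALITY: `dim Hom_HS(H^{2μ}Y, H^{2ν}Z(ν − μ)) ≤ ρ_μ(Y)ρ_ν(Z)` ⟹ `=`. [cite: VoisinHodgeI2002, §6.2.3 Cor. 6.26, Rem. 6.27 and §11.3.3 Lemma 11.41]
[cite: HulekLaface2019PicardNumbersAV, §2.1 Prop. 2.2] -/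
theorem BettiUniverse.finrank_hom_hodge_tateTwist_eq_mul_of_le (hHD : exists_isReal_hodgeModel) (hY : IsSmoothProjective m Y) (hZ : IsSmoothProjective n Z) {μ ν : ℕ} {s : ℤ}
    (hs : ((2 * ν : ℕ) : ℤ) - 2 * s = ((2 * μ : ℕ) : ℤ))
    (h : Module.finrank ℚ (Hom (BettiUniverse.hodge hHD hY (2 * μ)) (((BettiUniverse.hodge hHD hZ (2 * ν)).tateTwist s).cast hs)) ≤
      Module.finrank ℚ ↥((BettiUniverse.hodge hHD hY (2 * μ)).hodgeClasses μ) * Module.finrank ℚ ↥((BettiUniverse.hodge hHD hZ (2 * ν)).hodgeClasses ν)) :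
    Module.finrank ℚ (Hom (BettiUniverse.hodge hHD hY (2 * μ)) (((BettiUniverse.hodge hHD hZ (2 * ν)).tateTwist s).cast hs)) =
      Module.finrank ℚ ↥((BettiUniverse.hodge hHD hY (2 * μ)).hodgeClasses μ) * Module.finrank ℚ ↥((BettiUniverse.hodge hHD hZ (2 * ν)).hodgeClasses ν) :=
  le_antisymm h (BettiUniverse.mul_le_finrank_hom_hodge_tateTwist hHD hY hZ hs)

end EvenCount

section Criterion

/-- **`HC(Y × Z)` FROM `HC(Y)`, `HC(Z)` AND TWO TOP-DEGREE CONDITIONS, IN ALL DIMENSIONS.**  Let `Y`, `Z` be smooth projective of dimensions `m`, `n`; let `mₒ ≤ m ≤ mₒ + 1`, `nₒ ≤ n ≤ nₒ + 1`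
be odd (the top odd degrees) with `nₒ − 2s = mₒ`, and `2μ ≤ m ≤ 2μ + 1`, `2ν ≤ n ≤ 2ν + 1` (the top even degrees) with `2ν − 2s' = 2μ`.  If `HC(Y)`, `HC(Z)`,
**`Hom_HS(H^{mₒ}(Y), H^{nₒ}(Z)(s)) = 0`** and **`dim_ℚ Hom_HS(H^{2μ}(Y), H^{2ν}(Z)(s')) ≤ dim_ℚ Hdg^μ(H^{2μ}(Y)) · dim_ℚ Hdg^ν(H^{2ν}(Z))`**, then `HC(Y × Z)`: the first condition kills every odd
primitive block, the second saturates every even one (§2), and g39-#4's primitive-count criterion applies (reduction to the biprimitive pieces by hard Lefschetz, Thm. 11.38/11.40, Prop. 9.20;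
Lefschetz `(1,1)`-type algebraicity of the primitive Hodge classes under `HC(Y)`, `HC(Z)`). [cite: VoisinHodgeI2002, §6.2.3 Cor. 6.26, Rem. 6.27, §7.3.1 Lemma 7.23, Lemma 7.26, §11.3.3
Thm. 11.38–11.40, Lemma 11.41, p. 287] [cite: VoisinHodgeII2003, §9.2.4 Prop. 9.20] [cite: HulekLaface2019PicardNumbersAV, §2.1 Prop. 2.2] [cite: DeligneHodgeII1971, 2.1.13–2.1.15] [cite: Deligne2000, §1] -/
theorem BettiUniverse.hodgeConjectureFor_tensor_of_subsingleton_hom_hodge_odd_of_finrank_hom_hodge_even_le (hHD : exists_isReal_hodgeModel) (hY : IsSmoothProjective m Y)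
    (hZ : IsSmoothProjective n Z) (hYZ : IsSmoothProjective d (Y ⊗ Z)) (hHCY : HodgeConjectureFor m Y) (hHCZ : HodgeConjectureFor n Z) {mₒ nₒ : ℕ} (hmₒ : Odd mₒ) (hmₒm : mₒ ≤ m)
    (hmmₒ : m ≤ mₒ + 1) (hnₒ : Odd nₒ) (hnₒn : nₒ ≤ n) (hnnₒ : n ≤ nₒ + 1) {s : ℤ} (hs : (nₒ : ℤ) - 2 * s = mₒ)
    (hodd : Subsingleton (Hom (BettiUniverse.hodge hHD hY mₒ) (((BettiUniverse.hodge hHD hZ nₒ).tateTwist s).cast hs))) {μ ν : ℕ} (hμ : 2 * μ ≤ m) (hmμ : m ≤ 2 * μ + 1)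
    (hν : 2 * ν ≤ n) (hnν : n ≤ 2 * ν + 1) {s' : ℤ} (hs' : ((2 * ν : ℕ) : ℤ) - 2 * s' = ((2 * μ : ℕ) : ℤ))
    (heven : Module.finrank ℚ (Hom (BettiUniverse.hodge hHD hY (2 * μ)) (((BettiUniverse.hodge hHD hZ (2 * ν)).tateTwist s').cast hs')) ≤
      Module.finrank ℚ ↥((BettiUniverse.hodge hHD hY (2 * μ)).hodgeClasses μ) * Module.finrank ℚ ↥((BettiUniverse.hodge hHD hZ (2 * ν)).hodgeClasses ν)) :
    HodgeConjectureFor d (Y ⊗ Z) := by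
  haveI : HodgeTensorFacts.{0, 0} := hodgeTensorFacts_holds
  obtain ⟨DY⟩ := nonempty_kaehlerRationalDatum hY
  obtain ⟨DZ⟩ := nonempty_kaehlerRationalDatum hZ
  exact BettiUniverse.hodgeConjectureFor_tensor_of_subsingleton_hom_hodge_odd_of_finrank_hom_primitiveHodge_le hHD hY hZ hYZ DY DZ hHCY hHCZ hmₒ hmₒm hmmₒ hnₒ hnₒn
    hnnₒ hs hodd fun a b _ ha _ hb ↦ (BettiUniverse.finrank_hom_primitiveHodge_eq_mul_of_finrank_hom_hodge_le hHD hY hZ DY DZ hμ hν hs' heven (by omega) (by omega)).le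

end Criterion

section Instances

/-- **Equidimensional, even: `dim Y = dim Z = 2k` (`k ≥ 1`).  `HC(Y × Z)` ⟸ `HC(Y)`, `HC(Z)`, `Hom_HS(H^{2k−1}(Y), H^{2k−1}(Z)) = 0` and `dim_ℚ Hom_HS(H^{2k}(Y), H^{2k}(Z)) ≤ ρ_k(Y) ρ_k(Z)`.**
[cite: VoisinHodgeI2002, §6.2.3 Cor. 6.26, Rem. 6.27, §7.3.1 Lemma 7.23, Lemma 7.26, §11.3.3 Thm. 11.38–11.40, Lemma 11.41, p. 287] [cite: VoisinHodgeII2003, §9.2.4 Prop. 9.20] [cite: Deligne2000, §1] -/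
theorem BettiUniverse.hodgeConjectureFor_tensor_of_even_dim_of_subsingleton_hom_of_finrank_hom_le {k : ℕ} (hHD : exists_isReal_hodgeModel) (hY : IsSmoothProjective (2 * k) Y)
    (hZ : IsSmoothProjective (2 * k) Z) (hYZ : IsSmoothProjective d (Y ⊗ Z)) (hk : 1 ≤ k) (hHCY : HodgeConjectureFor (2 * k) Y) (hHCZ : HodgeConjectureFor (2 * k) Z)
    (hodd : Subsingleton (Hom (BettiUniverse.hodge hHD hY (2 * k - 1)) (BettiUniverse.hodge hHD hZ (2 * k - 1))))
    (heven : Module.finrank ℚ (Hom (BettiUniverse.hodge hHD hY (2 * k)) (BettiUniverse.hodge hHD hZ (2 * k))) ≤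
      Module.finrank ℚ ↥((BettiUniverse.hodge hHD hY (2 * k)).hodgeClasses k) * Module.finrank ℚ ↥((BettiUniverse.hodge hHD hZ (2 * k)).hodgeClasses k)) :
    HodgeConjectureFor d (Y ⊗ Z) :=
  BettiUniverse.hodgeConjectureFor_tensor_of_subsingleton_hom_hodge_odd_of_finrank_hom_hodge_even_le hHD hY hZ hYZ hHCY hHCZ (mₒ := 2 * k - 1) (nₒ := 2 * k - 1)
    ⟨k - 1, by omega⟩ (by omega) (by omega) ⟨k - 1, by omega⟩ (by omega) (by omega) (s := 0) (by simp) ((subsingleton_hom_twistCast_zero_right_iff _ _ _).2 hodd)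
    (μ := k) (ν := k) le_rfl (by omega) le_rfl (by omega) (s' := 0) (by simp) ((finrank_hom_twistCast_zero_right _ _ _).trans_le heven)

/-- **Equidimensional, odd: `dim Y = dim Z = 2k + 1`.  `HC(Y × Z)` ⟸ `HC(Y)`, `HC(Z)`, `Hom_HS(H^{2k+1}(Y), H^{2k+1}(Z)) = 0` and `dim_ℚ Hom_HS(H^{2k}(Y), H^{2k}(Z)) ≤ ρ_k(Y) ρ_k(Z)`**
(`k = 1`: two threefolds, g39-#3). [cite: VoisinHodgeI2002, §6.2.3 Cor. 6.26, Rem. 6.27, §7.3.1 Lemma 7.23, Lemma 7.26, §11.3.3 Thm. 11.38–11.40, Lemma 11.41, p. 287] [cite: VoisinHodgeII2003, §9.2.4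
Prop. 9.20] [cite: Deligne2000, §1] -/
theorem BettiUniverse.hodgeConjectureFor_tensor_of_odd_dim_of_subsingleton_hom_of_finrank_hom_le {k : ℕ} (hHD : exists_isReal_hodgeModel) (hY : IsSmoothProjective (2 * k + 1) Y)
    (hZ : IsSmoothProjective (2 * k + 1) Z) (hYZ : IsSmoothProjective d (Y ⊗ Z)) (hHCY : HodgeConjectureFor (2 * k + 1) Y) (hHCZ : HodgeConjectureFor (2 * k + 1) Z)
    (hodd : Subsingleton (Hom (BettiUniverse.hodge hHD hY (2 * k + 1)) (BettiUniverse.hodge hHD hZ (2 * k + 1))))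
    (heven : Module.finrank ℚ (Hom (BettiUniverse.hodge hHD hY (2 * k)) (BettiUniverse.hodge hHD hZ (2 * k))) ≤
      Module.finrank ℚ ↥((BettiUniverse.hodge hHD hY (2 * k)).hodgeClasses k) * Module.finrank ℚ ↥((BettiUniverse.hodge hHD hZ (2 * k)).hodgeClasses k)) :
    HodgeConjectureFor d (Y ⊗ Z) :=
  BettiUniverse.hodgeConjectureFor_tensor_of_subsingleton_hom_hodge_odd_of_finrank_hom_hodge_even_le hHD hY hZ hYZ hHCY hHCZ (mₒ := 2 * k + 1) (nₒ := 2 * k + 1)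
    ⟨k, rfl⟩ le_rfl (by omega) ⟨k, rfl⟩ le_rfl (by omega) (s := 0) (by simp) ((subsingleton_hom_twistCast_zero_right_iff _ _ _).2 hodd)
    (μ := k) (ν := k) (by omega) le_rfl (by omega) le_rfl (s' := 0) (by simp) ((finrank_hom_twistCast_zero_right _ _ _).trans_le heven)

/-- **Two fourfolds: `HC(F × F')` ⟸ `HC(F)`, `HC(F')`, `Hom_HS(H³(F), H³(F')) = 0` and `dim_ℚ Hom_HS(H⁴(F), H⁴(F')) ≤ ρ₂(F) ρ₂(F')`** (`ρ₂ = dim Hdg²(H⁴)`). [cite: VoisinHodgeI2002, §6.2.3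
Cor. 6.26, Rem. 6.27, §7.3.1 Lemma 7.23, Lemma 7.26, §11.3.3 Thm. 11.38–11.40, Lemma 11.41, p. 287] [cite: VoisinHodgeII2003, §9.2.4 Prop. 9.20] [cite: Deligne2000, §1] -/
theorem BettiUniverse.hodgeConjectureFor_tensor_fourfolds_of_subsingleton_hom_three_of_finrank_hom_four_le (hHD : exists_isReal_hodgeModel) (hF : IsSmoothProjective 4 F)
    (hF' : IsSmoothProjective 4 F') (hFF' : IsSmoothProjective 8 (F ⊗ F')) (hHC : HodgeConjectureFor 4 F) (hHC' : HodgeConjectureFor 4 F')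
    (h33 : Subsingleton (Hom (BettiUniverse.hodge hHD hF 3) (BettiUniverse.hodge hHD hF' 3)))
    (h44 : Module.finrank ℚ (Hom (BettiUniverse.hodge hHD hF 4) (BettiUniverse.hodge hHD hF' 4)) ≤
      Module.finrank ℚ ↥((BettiUniverse.hodge hHD hF 4).hodgeClasses 2) * Module.finrank ℚ ↥((BettiUniverse.hodge hHD hF' 4).hodgeClasses 2)) :
    HodgeConjectureFor 8 (F ⊗ F') :=
  BettiUniverse.hodgeConjectureFor_tensor_of_subsingleton_hom_hodge_odd_of_finrank_hom_hodge_even_le hHD hF hF' hFF' hHC hHC' (mₒ := 3) (nₒ := 3) (by decide) (by norm_num)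
    (by norm_num) (by decide) (by norm_num) (by norm_num) (s := 0) (by norm_num) ((subsingleton_hom_twistCast_zero_right_iff _ _ _).2 h33) (μ := 2) (ν := 2) (by norm_num)
    (by norm_num) (by norm_num) (by norm_num) (s' := 0) (by norm_num) ((finrank_hom_twistCast_zero_right _ _ _).trans_le h44)

/-- **A threefold and a fourfold: `HC(T × F)` ⟸ `HC(F)`, `Hom_HS(H³(T), H³(F)) = 0` and `dim_ℚ Hom_HS(H²(T), H⁴(F)(1)) ≤ ρ(T) ρ₂(F)`** (`HC(T)` holds for threefolds). [cite: VoisinHodgeI2002,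
§6.2.3 Cor. 6.26, Rem. 6.27, §7.3.1 Lemma 7.23, Lemma 7.26, §11.3.3 Thm. 11.38–11.40, Lemma 11.41, p. 287 and §11.3.1 Thm. 11.30] [cite: VoisinHodgeII2003, §9.2.4 Prop. 9.20] [cite: Deligne2000, §1] -/
theorem BettiUniverse.hodgeConjectureFor_threefold_tensor_fourfold_of_subsingleton_hom_three_of_finrank_hom_two_four_le (hHD : exists_isReal_hodgeModel)
    (hT : IsSmoothProjective 3 T) (hF : IsSmoothProjective 4 F) (hTF : IsSmoothProjective 7 (T ⊗ F)) (hHC' : HodgeConjectureFor 4 F)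
    (h33 : Subsingleton (Hom (BettiUniverse.hodge hHD hT 3) (BettiUniverse.hodge hHD hF 3)))
    (h24 : Module.finrank ℚ (Hom (BettiUniverse.hodge hHD hT 2) (((BettiUniverse.hodge hHD hF 4).tateTwist 1).cast (by norm_num))) ≤
      Module.finrank ℚ ↥((BettiUniverse.hodge hHD hT 2).hodgeClasses 1) * Module.finrank ℚ ↥((BettiUniverse.hodge hHD hF 4).hodgeClasses 2)) :
    HodgeConjectureFor 7 (T ⊗ F) :=
  BettiUniverse.hodgeConjectureFor_tensor_of_subsingleton_hom_hodge_odd_of_finrank_hom_hodge_even_le hHD hT hF hTF (hodgeConjectureFor_of_dim_le_three_holds le_rfl hT) hHC'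
    (mₒ := 3) (nₒ := 3) (by decide) (by norm_num) (by norm_num) (by decide) (by norm_num) (by norm_num) (s := 0) (by norm_num)
    ((subsingleton_hom_twistCast_zero_right_iff _ _ _).2 h33) (μ := 1) (ν := 2) (by norm_num) (by norm_num) (by norm_num) (by norm_num) (s' := 1) (by norm_num) h24

/-- **A surface and a fourfold: `HC(S × F)` ⟸ `HC(F)`, `Hom_HS(H¹(S), H³(F)(1)) = 0` and `dim_ℚ Hom_HS(H²(S), H⁴(F)(1)) ≤ ρ(S) ρ₂(F)`** (`HC(S)` holds). [cite: VoisinHodgeI2002, §6.2.3 Cor. 6.26,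
Rem. 6.27, §7.3.1 Lemma 7.23, Lemma 7.26, §11.3.3 Thm. 11.38–11.40, Lemma 11.41, p. 287 and §11.3.1 Thm. 11.30] [cite: VoisinHodgeII2003, §9.2.4 Prop. 9.20] [cite: Deligne2000, §1] -/
theorem BettiUniverse.hodgeConjectureFor_surface_tensor_fourfold_of_subsingleton_hom_one_three_of_finrank_hom_two_four_le (hHD : exists_isReal_hodgeModel)
    (hS : IsSmoothProjective 2 Y) (hF : IsSmoothProjective 4 F) (hSF : IsSmoothProjective 6 (Y ⊗ F)) (hHC' : HodgeConjectureFor 4 F)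
    (h13 : Subsingleton (Hom (BettiUniverse.hodge hHD hS 1) (((BettiUniverse.hodge hHD hF 3).tateTwist 1).cast (by norm_num))))
    (h24 : Module.finrank ℚ (Hom (BettiUniverse.hodge hHD hS 2) (((BettiUniverse.hodge hHD hF 4).tateTwist 1).cast (by norm_num))) ≤
      Module.finrank ℚ ↥((BettiUniverse.hodge hHD hS 2).hodgeClasses 1) * Module.finrank ℚ ↥((BettiUniverse.hodge hHD hF 4).hodgeClasses 2)) :
    HodgeConjectureFor 6 (Y ⊗ F) :=
  BettiUniverse.hodgeConjectureFor_tensor_of_subsingleton_hom_hodge_odd_of_finrank_hom_hodge_even_le hHD hS hF hSF (hodgeConjectureFor_of_dim_le_three_holds (by norm_num) hS) hHC'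
    (mₒ := 1) (nₒ := 3) (by decide) (by norm_num) (by norm_num) (by decide) (by norm_num) (by norm_num) (s := 1) (by norm_num) h13 (μ := 1) (ν := 2) (by norm_num) (by norm_num)
    (by norm_num) (by norm_num) (s' := 1) (by norm_num) h24

end Instances

section NoTopOddCohomology

/-- `Hom_HS(Hⁱ(Y), K) = 0` for every Hodge structure `K` when `bᵢ(Y) = 0`. [cite: DeligneHodgeII1971, 2.1] -/
theorem BettiUniverse.subsingleton_hom_hodge_of_finrank_eq_zero (hHD : exists_isReal_hodgeModel) (hY : IsSmoothProjective m Y) {i : ℕ}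
    (h0 : Module.finrank ℚ (bettiCohomology Y i) = 0) {W : Type} [AddCommGroup W] [Module ℚ W] (K : HodgeStructure W (i : ℤ)) :
    Subsingleton (Hom (BettiUniverse.hodge hHD hY i) K) := by
  haveI := BettiUniverse.finite hY i
  haveI : Subsingleton (bettiCohomology Y i) := Module.finrank_zero_iff.1 h0
  exact Hom.toLinearMap_injective.subsingleton

/-- `Hom_HS(K, Hʲ(Z)(s)) = 0` for every Hodge structure `K` when `bⱼ(Z) = 0`. [cite: DeligneHodgeII1971, 2.1] -/
theorem BettiUniverse.subsingleton_hom_hodge_tateTwist_of_finrank_eq_zero (hHD : exists_isReal_hodgeModel) (hZ : IsSmoothProjective n Z) {j : ℕ}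
    (h0 : Module.finrank ℚ (bettiCohomology Z j) = 0) {V : Type} [AddCommGroup V] [Module ℚ V] {w : ℤ} (K : HodgeStructure V w) {s : ℤ} (hs : (j : ℤ) - 2 * s = w) :
    Subsingleton (Hom K (((BettiUniverse.hodge hHD hZ j).tateTwist s).cast hs)) := by
  haveI := BettiUniverse.finite hZ j
  haveI : Subsingleton (bettiCohomology Z j) := Module.finrank_zero_iff.1 h0
  exact Hom.toLinearMap_injective.subsingleton

/-- **ONE FACTOR WITHOUT COHOMOLOGY IN ITS TOP ODD DEGREE: `HC(Y × Z)` ⟸ `HC(Y)`, `HC(Z)` and the top even count alone.**  If `b_{mₒ}(Y) = 0` for the top odd degree `mₒ ≤ m ≤ mₒ + 1`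
(so `Y` has no odd rational cohomology in degrees `≤ dim Y`, by hard Lefschetz), `dim Z ≥ 1`, `HC(Y)`, `HC(Z)` and `dim_ℚ Hom_HS(H^{2μ}(Y), H^{2ν}(Z)(s')) ≤ ρ_μ(Y) ρ_ν(Z)` for the top even degrees
`2μ ≤ m ≤ 2μ + 1`, `2ν ≤ n ≤ 2ν + 1` (`2ν − 2s' = 2μ`), then `HC(Y × Z)`. [cite: VoisinHodgeI2002, §6.2.3 Thm. 6.25, Cor. 6.26, Rem. 6.27, §7.3.1 Lemma 7.23, Lemma 7.26, §11.3.3 Thm. 11.38–11.40,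
Lemma 11.41, p. 287] [cite: VoisinHodgeII2003, §9.2.4 Prop. 9.20] [cite: HulekLaface2019PicardNumbersAV, §2.1 Prop. 2.2] [cite: Deligne2000, §1] -/
theorem BettiUniverse.hodgeConjectureFor_tensor_of_finrank_top_odd_eq_zero_left_of_finrank_hom_hodge_even_le (hHD : exists_isReal_hodgeModel) (hY : IsSmoothProjective m Y)
    (hZ : IsSmoothProjective n Z) (hYZ : IsSmoothProjective d (Y ⊗ Z)) (hHCY : HodgeConjectureFor m Y) (hHCZ : HodgeConjectureFor n Z) {mₒ : ℕ} (hmₒ : Odd mₒ) (hmₒm : mₒ ≤ m)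
    (hmmₒ : m ≤ mₒ + 1) (h0 : Module.finrank ℚ (bettiCohomology Y mₒ) = 0) (hn : 1 ≤ n) {μ ν : ℕ} (hμ : 2 * μ ≤ m) (hmμ : m ≤ 2 * μ + 1) (hν : 2 * ν ≤ n)
    (hnν : n ≤ 2 * ν + 1) {s' : ℤ} (hs' : ((2 * ν : ℕ) : ℤ) - 2 * s' = ((2 * μ : ℕ) : ℤ))
    (heven : Module.finrank ℚ (Hom (BettiUniverse.hodge hHD hY (2 * μ)) (((BettiUniverse.hodge hHD hZ (2 * ν)).tateTwist s').cast hs')) ≤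
      Module.finrank ℚ ↥((BettiUniverse.hodge hHD hY (2 * μ)).hodgeClasses μ) * Module.finrank ℚ ↥((BettiUniverse.hodge hHD hZ (2 * ν)).hodgeClasses ν)) :
    HodgeConjectureFor d (Y ⊗ Z) := by
  obtain ⟨k, hk⟩ := hmₒ
  -- the top odd degree `nₒ` of `Z` and the twist `s = (nₒ − mₒ)/2`
  obtain ⟨l, hl | hl⟩ := Nat.even_or_odd' n
  · exact BettiUniverse.hodgeConjectureFor_tensor_of_subsingleton_hom_hodge_odd_of_finrank_hom_hodge_even_le hHD hY hZ hYZ hHCY hHCZ ⟨k, hk⟩ hmₒm hmmₒ (nₒ := 2 * l - 1)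
      ⟨l - 1, by omega⟩ (by omega) (by omega) (s := (l : ℤ) - 1 - k) (by push_cast [Nat.cast_sub (show 1 ≤ 2 * l by omega)]; omega)
      (BettiUniverse.subsingleton_hom_hodge_of_finrank_eq_zero hHD hY h0 _) hμ hmμ hν hnν hs' heven
  · exact BettiUniverse.hodgeConjectureFor_tensor_of_subsingleton_hom_hodge_odd_of_finrank_hom_hodge_even_le hHD hY hZ hYZ hHCY hHCZ ⟨k, hk⟩ hmₒm hmmₒ (nₒ := 2 * l + 1)
      ⟨l, rfl⟩ (by omega) (by omega) (s := (l : ℤ) - k) (by push_cast; omega) (BettiUniverse.subsingleton_hom_hodge_of_finrank_eq_zero hHD hY h0 _) hμ hmμ hν hnν hs' heven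

/-- The mirror: **`b_{nₒ}(Z) = 0` for the top odd degree of `Z`, `dim Y ≥ 1`, `HC(Y)`, `HC(Z)` and the top even count ⟹ `HC(Y × Z)`.** [cite: VoisinHodgeI2002, §6.2.3 Thm. 6.25, Cor. 6.26, Rem. 6.27,
§7.3.1 Lemma 7.23, Lemma 7.26, §11.3.3 Thm. 11.38–11.40, Lemma 11.41, p. 287] [cite: VoisinHodgeII2003, §9.2.4 Prop. 9.20] [cite: HulekLaface2019PicardNumbersAV, §2.1 Prop. 2.2] [cite: Deligne2000, §1] -/
theorem BettiUniverse.hodgeConjectureFor_tensor_of_finrank_top_odd_eq_zero_right_of_finrank_hom_hodge_even_le (hHD : exists_isReal_hodgeModel) (hY : IsSmoothProjective m Y)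
    (hZ : IsSmoothProjective n Z) (hYZ : IsSmoothProjective d (Y ⊗ Z)) (hHCY : HodgeConjectureFor m Y) (hHCZ : HodgeConjectureFor n Z) (hm : 1 ≤ m) {nₒ : ℕ} (hnₒ : Odd nₒ)
    (hnₒn : nₒ ≤ n) (hnnₒ : n ≤ nₒ + 1) (h0 : Module.finrank ℚ (bettiCohomology Z nₒ) = 0) {μ ν : ℕ} (hμ : 2 * μ ≤ m) (hmμ : m ≤ 2 * μ + 1) (hν : 2 * ν ≤ n)
    (hnν : n ≤ 2 * ν + 1) {s' : ℤ} (hs' : ((2 * ν : ℕ) : ℤ) - 2 * s' = ((2 * μ : ℕ) : ℤ))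
    (heven : Module.finrank ℚ (Hom (BettiUniverse.hodge hHD hY (2 * μ)) (((BettiUniverse.hodge hHD hZ (2 * ν)).tateTwist s').cast hs')) ≤
      Module.finrank ℚ ↥((BettiUniverse.hodge hHD hY (2 * μ)).hodgeClasses μ) * Module.finrank ℚ ↥((BettiUniverse.hodge hHD hZ (2 * ν)).hodgeClasses ν)) :
    HodgeConjectureFor d (Y ⊗ Z) := by
  obtain ⟨l, hl⟩ := hnₒ
  obtain ⟨k, hk | hk⟩ := Nat.even_or_odd' m
  · exact BettiUniverse.hodgeConjectureFor_tensor_of_subsingleton_hom_hodge_odd_of_finrank_hom_hodge_even_le hHD hY hZ hYZ hHCY hHCZ (mₒ := 2 * k - 1) ⟨k - 1, by omega⟩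
      (by omega) (by omega) ⟨l, hl⟩ hnₒn hnnₒ (s := (l : ℤ) + 1 - k) (by push_cast [Nat.cast_sub (show 1 ≤ 2 * k by omega)]; omega)
      (BettiUniverse.subsingleton_hom_hodge_tateTwist_of_finrank_eq_zero hHD hZ h0 _ _) hμ hmμ hν hnν hs' heven
  · exact BettiUniverse.hodgeConjectureFor_tensor_of_subsingleton_hom_hodge_odd_of_finrank_hom_hodge_even_le hHD hY hZ hYZ hHCY hHCZ (mₒ := 2 * k + 1) ⟨k, rfl⟩
      (by omega) (by omega) ⟨l, hl⟩ hnₒn hnnₒ (s := (l : ℤ) - k) (by push_cast; omega) (BettiUniverse.subsingleton_hom_hodge_tateTwist_of_finrank_eq_zero hHD hZ h0 _ _)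
      hμ hmμ hν hnν hs' heven

/-- **A surface with `b₁(S) = 0` times an `n`-fold (`n ≥ 1`): `HC(S × Z)` ⟸ `HC(Z)` and `dim_ℚ Hom_HS(H²(S), H^{2ν}(Z)(ν − 1)) ≤ ρ(S) ρ_ν(Z)`** for the top even degree `2ν ≤ n ≤ 2ν + 1`
(`HC(S)` holds; e.g. K3, Enriques, rational surfaces, regular surfaces of general type). [cite: VoisinHodgeI2002, §6.2.3 Thm. 6.25, Cor. 6.26, Rem. 6.27, §7.3.1 Lemma 7.23, Lemma 7.26, §11.3.3
Thm. 11.38–11.40, Lemma 11.41, p. 287 and §11.3.1 Thm. 11.30] [cite: VoisinHodgeII2003, §9.2.4 Prop. 9.20] [cite: Deligne2000, §1] -/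
theorem BettiUniverse.hodgeConjectureFor_surface_tensor_of_finrank_one_eq_zero_of_finrank_hom_hodge_le (hHD : exists_isReal_hodgeModel) (hS : IsSmoothProjective 2 Y)
    (hZ : IsSmoothProjective n Z) (hSZ : IsSmoothProjective d (Y ⊗ Z)) (hHCZ : HodgeConjectureFor n Z) (hb1 : Module.finrank ℚ (bettiCohomology Y 1) = 0) (hn : 1 ≤ n) {ν : ℕ}
    (hν : 2 * ν ≤ n) (hnν : n ≤ 2 * ν + 1) {s' : ℤ} (hs' : ((2 * ν : ℕ) : ℤ) - 2 * s' = ((2 : ℕ) : ℤ))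
    (heven : Module.finrank ℚ (Hom (BettiUniverse.hodge hHD hS 2) (((BettiUniverse.hodge hHD hZ (2 * ν)).tateTwist s').cast hs')) ≤
      Module.finrank ℚ ↥((BettiUniverse.hodge hHD hS 2).hodgeClasses 1) * Module.finrank ℚ ↥((BettiUniverse.hodge hHD hZ (2 * ν)).hodgeClasses ν)) :
    HodgeConjectureFor d (Y ⊗ Z) :=
  BettiUniverse.hodgeConjectureFor_tensor_of_finrank_top_odd_eq_zero_left_of_finrank_hom_hodge_even_le hHD hS hZ hSZ (hodgeConjectureFor_of_dim_le_three_holds (by norm_num) hS) hHCZ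
    (mₒ := 1) (by decide) (by norm_num) (by norm_num) hb1 hn (μ := 1) (by norm_num) (by norm_num) hν hnν hs' heven

/-- **A threefold with `b₃(T) = 0` times an `n`-fold (`n ≥ 1`): `HC(T × Z)` ⟸ `HC(Z)` and `dim_ℚ Hom_HS(H²(T), H^{2ν}(Z)(ν − 1)) ≤ ρ(T) ρ_ν(Z)`** for the top even degree `2ν ≤ n ≤ 2ν + 1`
(`HC(T)` holds; `b₁(T) = 0` follows from `b₃(T) = 0` by hard Lefschetz; e.g. `ℙ³`, the quadric threefold, Fano threefolds with `h^{1,2} = 0`). [cite: VoisinHodgeI2002, §6.2.3 Thm. 6.25, Cor. 6.26,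
Rem. 6.27, §7.3.1 Lemma 7.23, Lemma 7.26, §11.3.3 Thm. 11.38–11.40, Lemma 11.41, p. 287 and §11.3.1 Thm. 11.30] [cite: VoisinHodgeII2003, §9.2.4 Prop. 9.20] [cite: Deligne2000, §1] -/
theorem BettiUniverse.hodgeConjectureFor_threefold_tensor_of_finrank_three_eq_zero_of_finrank_hom_hodge_le (hHD : exists_isReal_hodgeModel) (hT : IsSmoothProjective 3 T)
    (hZ : IsSmoothProjective n Z) (hTZ : IsSmoothProjective d (T ⊗ Z)) (hHCZ : HodgeConjectureFor n Z) (hb3 : Module.finrank ℚ (bettiCohomology T 3) = 0) (hn : 1 ≤ n) {ν : ℕ}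
    (hν : 2 * ν ≤ n) (hnν : n ≤ 2 * ν + 1) {s' : ℤ} (hs' : ((2 * ν : ℕ) : ℤ) - 2 * s' = ((2 : ℕ) : ℤ))
    (heven : Module.finrank ℚ (Hom (BettiUniverse.hodge hHD hT 2) (((BettiUniverse.hodge hHD hZ (2 * ν)).tateTwist s').cast hs')) ≤
      Module.finrank ℚ ↥((BettiUniverse.hodge hHD hT 2).hodgeClasses 1) * Module.finrank ℚ ↥((BettiUniverse.hodge hHD hZ (2 * ν)).hodgeClasses ν)) :
    HodgeConjectureFor d (T ⊗ Z) :=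
  BettiUniverse.hodgeConjectureFor_tensor_of_finrank_top_odd_eq_zero_left_of_finrank_hom_hodge_even_le hHD hT hZ hTZ (hodgeConjectureFor_of_dim_le_three_holds le_rfl hT) hHCZ
    (mₒ := 3) (by decide) (by norm_num) (by norm_num) hb3 hn (μ := 1) (by norm_num) (by norm_num) hν hnν hs' heven

end NoTopOddCohomology

end Literature.AlgebraicGeometry.HodgeTheory

end
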